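import Summits.KontsevichZagierPeriods.KontsevichZagierPeriods.Theses.HardSphereVirial

/-!
# `PentagonNodes` (stmt-KontsevichZagierPeriods-8529, route HardSphereVirial) — proof

For `t : Fin 5 → ℂ`, `t ≠ 0`, with `e₁(t) = ∑ tᵢ = 0` and `e₄(t) = ∑ᵢ ∏_{j ≠ i} tⱼ = 0`, the five
"partial `e₃`'s" `pᵢ := e₃(t with tᵢ removed)` are all equal iff `t` is a permutation of
`(a, -a, 0, 0, 0)` with `a ≠ 0` (the ten nodes of the quartic surface `{e₁ = e₄ = 0} ⊂ ℙ⁴`).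

Proof.  The sums over `Fin 5` are expanded into explicit polynomials (`psum_expand`,
`pᵢ = e₃ - tᵢ e₂ + tᵢ² e₁ - tᵢ³`).  (⇐) is a direct computation, transported along the
permutation (`psum_comp_perm`).  (⇒): an explicit Nullstellensatz certificate (`core01`, checked by
`linear_combination`) shows that the hypotheses force `t₀² t₁² (t₀ + t₁)² = 0`; transporting along
permutations gives `tᵢ + tⱼ = 0` whenever `tᵢ, tⱼ ≠ 0`, `i ≠ j` (`pair_sum_eq_zero`).  Hence at most —
and by `e₁ = 0`, `t ≠ 0` exactly — two coordinates are non-zero, and they are opposite; a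
permutation moving them to the first two slots finishes (`exists_perm_zero_one`).
-/

namespace Summit.KontsevichZagierPeriods.HardSphereVirial

open Finset

/-- Expansion of the partial `e₃`-sums: `∑_{S ⊆ univ∖{i}, |S|=3} ∏_{j∈S} tⱼ = e₃ - tᵢe₂ + tᵢ²e₁ - tᵢ³`
with `e₁, e₂, e₃` the elementary symmetric polynomials of `t₀,…,t₄`, written out. [folklore] -/
theorem psum_expand (t : Fin 5 → ℂ) (i : Fin 5) :
    (∑ S ∈ (univ.erase i).powersetCard 3, ∏ j ∈ S, t j)
      = (t 0 * t 1 * t 2 + t 0 * t 1 * t 3 + t 0 * t 1 * t 4 + t 0 * t 2 * t 3 + t 0 * t 2 * t 4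
          + t 0 * t 3 * t 4 + t 1 * t 2 * t 3 + t 1 * t 2 * t 4 + t 1 * t 3 * t 4 + t 2 * t 3 * t 4)
        - t i * (t 0 * t 1 + t 0 * t 2 + t 0 * t 3 + t 0 * t 4 + t 1 * t 2 + t 1 * t 3 + t 1 * t 4
          + t 2 * t 3 + t 2 * t 4 + t 3 * t 4)
        + t i ^ 2 * (t 0 + t 1 + t 2 + t 3 + t 4) - t i ^ 3 := by
  have h0 : (univ.erase (0 : Fin 5)).powersetCard 3
      = {{1, 2, 3}, {1, 2, 4}, {1, 3, 4}, {2, 3, 4}} := by decide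
  have h1 : (univ.erase (1 : Fin 5)).powersetCard 3
      = {{0, 2, 3}, {0, 2, 4}, {0, 3, 4}, {2, 3, 4}} := by decide
  have h2 : (univ.erase (2 : Fin 5)).powersetCard 3
      = {{0, 1, 3}, {0, 1, 4}, {0, 3, 4}, {1, 3, 4}} := by decide
  have h3 : (univ.erase (3 : Fin 5)).powersetCard 3
      = {{0, 1, 2}, {0, 1, 4}, {0, 2, 4}, {1, 2, 4}} := by decide
  have h4 : (univ.erase (4 : Fin 5)).powersetCard 3
      = {{0, 1, 2}, {0, 1, 3}, {0, 2, 3}, {1, 2, 3}} := by decide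
  fin_cases i <;> simp (decide := true) [h0, h1, h2, h3, h4, sum_insert, prod_insert] <;> ring

/-- Expansion of `e₄(t) = ∑ᵢ ∏_{j ≠ i} tⱼ` over `Fin 5`. [folklore] -/
theorem e4_expand (t : Fin 5 → ℂ) :
    (∑ i, ∏ j ∈ univ.erase i, t j) = t 1 * t 2 * t 3 * t 4 + t 0 * t 2 * t 3 * t 4
      + t 0 * t 1 * t 3 * t 4 + t 0 * t 1 * t 2 * t 4 + t 0 * t 1 * t 2 * t 3 := by
  have h0 : univ.erase (0 : Fin 5) = {1, 2, 3, 4} := by decide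
  have h1 : univ.erase (1 : Fin 5) = {0, 2, 3, 4} := by decide
  have h2 : univ.erase (2 : Fin 5) = {0, 1, 3, 4} := by decide
  have h3 : univ.erase (3 : Fin 5) = {0, 1, 2, 4} := by decide
  have h4 : univ.erase (4 : Fin 5) = {0, 1, 2, 3} := by decide
  rw [Fin.sum_univ_five, h0, h1, h2, h3, h4]
  simp [prod_insert]; ring

/-- Transport of the partial `e₃`-sums along a permutation `σ` of the indices. [folklore] -/
theorem psum_comp_perm (t : Fin 5 → ℂ) (σ : Equiv.Perm (Fin 5)) (i : Fin 5) :
    (∑ S ∈ (univ.erase i).powersetCard 3, ∏ j ∈ S, t (σ j))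
      = ∑ S ∈ (univ.erase (σ i)).powersetCard 3, ∏ j ∈ S, t j := by
  have hs : (univ.erase i).map σ.toEmbedding = univ.erase (σ i) := by
    rw [map_erase, map_univ_equiv]; rfl
  rw [← hs, powersetCard_map, sum_map]
  simp [mapEmbedding_apply, prod_map]

/-- Transport of `e₄(t) = ∑ᵢ ∏_{j ≠ i} tⱼ` along a permutation of the indices. [folklore] -/
theorem e4_comp_perm (t : Fin 5 → ℂ) (σ : Equiv.Perm (Fin 5)) :
    (∑ i, ∏ j ∈ univ.erase i, t (σ j)) = ∑ i, ∏ j ∈ univ.erase i, t j := by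
  rw [← Equiv.sum_comp σ (fun i => ∏ j ∈ univ.erase i, t j)]
  refine sum_congr rfl fun i _ => ?_
  have hs : (univ.erase i).map σ.toEmbedding = univ.erase (σ i) := by
    rw [map_erase, map_univ_equiv]; rfl
  rw [← hs, prod_map]
  rfl

/-- A permutation of `Fin 5` sending `0 ↦ i` and `1 ↦ j` for `i ≠ j` (a product of two
transpositions). [folklore] -/
theorem exists_perm_zero_one (i j : Fin 5) (hij : i ≠ j) :
    ∃ τ : Equiv.Perm (Fin 5), τ 0 = i ∧ τ 1 = j := by
  have hj'0 : Equiv.swap 0 i j ≠ 0 := by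
    intro h
    have : Equiv.swap 0 i (Equiv.swap 0 i j) = j := by simp
    rw [h, Equiv.swap_apply_left] at this
    exact hij this
  refine ⟨Equiv.swap 0 i * Equiv.swap 1 (Equiv.swap 0 i j), ?_, ?_⟩
  · simp only [Equiv.Perm.mul_apply]
    rw [Equiv.swap_apply_of_ne_of_ne (by decide) hj'0.symm, Equiv.swap_apply_left]
  · simp only [Equiv.Perm.mul_apply, Equiv.swap_apply_left]
    simp

/-- The algebraic core (a Nullstellensatz certificate): under `e₁ = 0`, `e₄ = 0` and equality of all
partial `e₃`'s, `t₀² t₁² (t₀ + t₁)² = 0`.  The cubic `t₀t₁(t₀+t₁)` vanishes on the ten nodes but is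
not in the (homogeneous) ideal `⟨e₁, e₄, pᵢ - pⱼ⟩`; its square is, in degree `6`, and the cofactors
below were found by linear algebra over `ℚ` (69 terms). [folklore] -/
theorem core01 (t : Fin 5 → ℂ) (h1 : (∑ i, t i) = 0) (h4 : (∑ i, ∏ j ∈ univ.erase i, t j) = 0)
    (hp : ∀ i i' : Fin 5, (∑ S ∈ (univ.erase i).powersetCard 3, ∏ j ∈ S, t j)
      = (∑ S ∈ (univ.erase i').powersetCard 3, ∏ j ∈ S, t j)) :
    t 0 ^ 2 * t 1 ^ 2 * (t 0 + t 1) ^ 2 = 0 := by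
  rw [Fin.sum_univ_five] at h1
  rw [e4_expand] at h4
  have hp1 := hp 0 1
  have hp2 := hp 0 2
  have hp3 := hp 0 3
  have hp4 := hp 0 4
  simp only [psum_expand] at hp1 hp2 hp3 hp4
  linear_combination (t 0 ^ 3 * t 1 ^ 2 + t 0 ^ 2 * t 1 ^ 3 - 2 / 15 * t 0 ^ 2 * t 1 ^ 2 * t 3 - 1
    / 3 * t 0 ^ 2 * t 1 * t 2 ^ 2 - 1 / 10 * t 0 ^ 2 * t 1 * t 2 * t 3 - 2 / 15 * t 0 ^ 2 * t 1 *
    t 3 ^ 2 + 1 / 3 * t 0 ^ 2 * t 2 ^ 2 * t 3 + 2 / 15 * t 0 ^ 2 * t 2 * t 3 ^ 2 + 1 / 15 * t 0 *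
    t 1 ^ 2 * t 2 ^ 2 - 1 / 10 * t 0 * t 1 ^ 2 * t 2 * t 3 + 2 / 15 * t 0 * t 1 * t 2 ^ 2 * t 3 +
    2 / 15 * t 0 * t 1 * t 2 * t 3 ^ 2 - 4 / 15 * t 0 * t 2 ^ 2 * t 3 ^ 2 - 1 / 15 * t 1 ^ 2 * t 2
    ^ 2 * t 3 + 4 / 15 * t 1 * t 2 ^ 2 * t 3 ^ 2) * h1 + (-1 / 15 * t 0 ^ 2 - 9 / 5 * t 0 * t 1 -
    2 / 15 * t 0 * t 2 - 2 / 15 * t 0 * t 3 - 1 / 15 * t 1 ^ 2 - 2 / 15 * t 1 * t 2 - 2 / 15 * t 1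
    * t 3 + 4 / 15 * t 2 ^ 2 + 4 / 5 * t 2 * t 3 + 4 / 15 * t 3 ^ 2) * h4 + (-1 / 15 * t 0 ^ 2 * t
    1 + 1 / 3 * t 0 ^ 2 * t 2 + 2 / 15 * t 0 ^ 2 * t 3 - 5 / 6 * t 0 * t 1 ^ 2 + 17 / 30 * t 0 * t
    1 * t 2 + 11 / 30 * t 0 * t 1 * t 3 + 1 / 3 * t 0 * t 2 ^ 2 + 1 / 5 * t 0 * t 2 * t 3 + 2 / 15
    * t 0 * t 3 ^ 2 + 1 / 10 * t 1 ^ 2 * t 2 - 1 / 10 * t 1 ^ 2 * t 3 + 1 / 5 * t 1 * t 2 ^ 2 + 1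
    / 5 * t 1 * t 2 * t 3 - 4 / 15 * t 2 ^ 2 * t 3 - 4 / 15 * t 2 * t 3 ^ 2) * hp1 + (13 / 30 * t
    0 ^ 2 * t 1 - 7 / 30 * t 0 ^ 2 * t 2 - 2 / 15 * t 0 ^ 2 * t 3 + 13 / 30 * t 0 * t 1 ^ 2 - 7 /
    15 * t 0 * t 1 * t 2 - 4 / 15 * t 0 * t 1 * t 3 - 1 / 3 * t 0 * t 2 ^ 2 - 11 / 30 * t 0 * t 2
    * t 3 - 2 / 15 * t 0 * t 3 ^ 2 - 1 / 10 * t 1 ^ 2 * t 2 - 1 / 5 * t 1 * t 2 ^ 2 - 7 / 30 * t 1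
    * t 2 * t 3 + 2 / 15 * t 2 ^ 2 * t 3) * hp2 + (17 / 30 * t 0 ^ 2 * t 1 - 1 / 3 * t 0 ^ 2 * t 2
    - 3 / 10 * t 0 ^ 2 * t 3 + 17 / 30 * t 0 * t 1 ^ 2 - 4 / 15 * t 0 * t 1 * t 2 - 1 / 3 * t 0 *
    t 1 * t 3 - 1 / 3 * t 0 * t 2 ^ 2 - 17 / 30 * t 0 * t 2 * t 3 - 2 / 5 * t 0 * t 3 ^ 2 + 1 / 15
    * t 1 ^ 2 * t 2 + 1 / 10 * t 1 ^ 2 * t 3 + 1 / 15 * t 1 * t 2 ^ 2 - 1 / 6 * t 1 * t 2 * t 3 -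
    2 / 15 * t 2 ^ 2 * t 3) * hp3 + (13 / 30 * t 0 ^ 2 * t 1 + 13 / 30 * t 0 * t 1 ^ 2) * hp4

/-- Two non-zero coordinates at distinct indices are opposite. [folklore] -/
theorem pair_sum_eq_zero (t : Fin 5 → ℂ) (h1 : (∑ i, t i) = 0)
    (h4 : (∑ i, ∏ j ∈ univ.erase i, t j) = 0)
    (hp : ∀ i i' : Fin 5, (∑ S ∈ (univ.erase i).powersetCard 3, ∏ j ∈ S, t j)
      = (∑ S ∈ (univ.erase i').powersetCard 3, ∏ j ∈ S, t j))
    (i j : Fin 5) (hij : i ≠ j) (hi : t i ≠ 0) (hj : t j ≠ 0) : t i + t j = 0 := by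
  obtain ⟨τ, hτ0, hτ1⟩ := exists_perm_zero_one i j hij
  have key := core01 (fun k => t (τ k)) (by rw [Equiv.sum_comp τ t]; exact h1)
    (by rw [e4_comp_perm]; exact h4)
    (by intro k k'; rw [psum_comp_perm, psum_comp_perm]; exact hp _ _)
  simp only [hτ0, hτ1] at key
  simpa [hi, hj] using key

/-- **`PentagonNodes`** (route HardSphereVirial, stmt-KontsevichZagierPeriods-8529): for
`t : Fin 5 → ℂ`, `t ≠ 0`, with `∑ tᵢ = 0` and `∑ᵢ ∏_{j≠i} tⱼ = 0`, the partial `e₃`-sums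
`∑_{S ⊆ univ∖{i}, |S| = 3} ∏_{j∈S} tⱼ` are independent of `i` iff `t ∘ σ = (a, -a, 0, 0, 0)` for some
permutation `σ` and some `a ≠ 0`.  Proof: explicit expansion, a `linear_combination` certificate for
`t₀²t₁²(t₀+t₁)² = 0`, transport along permutations, and a two-transposition normal form. [folklore] -/
theorem pentagonNodes_proof :
    Summit.KontsevichZagierPeriods.KontsevichZagierPeriods.Theses.HardSphereVirial.PentagonNodes := by
  intro t ht h1 h4
  constructor
  · intro hp
    obtain ⟨i, hi⟩ : ∃ i, t i ≠ 0 := by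
      by_contra h
      push Not at h
      exact ht (funext h)
    obtain ⟨j, hji, hj⟩ : ∃ j, j ≠ i ∧ t j ≠ 0 := by
      by_contra h
      push Not at h
      have hs : (∑ k, t k) = t i := Finset.sum_eq_single i (fun b _ hb => h b hb) (by simp)
      exact hi (hs ▸ h1)
    have hij : t i + t j = 0 := pair_sum_eq_zero t h1 h4 hp i j hji.symm hi hj
    have hk : ∀ k, k ≠ i → k ≠ j → t k = 0 := by
      intro k hki hkj
      by_contra hk
      have h1' := pair_sum_eq_zero t h1 h4 hp i k hki.symm hi hk
      have h2' := pair_sum_eq_zero t h1 h4 hp j k hkj.symm hj hk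
      exact hi (by linear_combination (hij + h1' - h2') / 2)
    obtain ⟨τ, hτ0, hτ1⟩ := exists_perm_zero_one i j hji.symm
    refine ⟨τ, t i, hi, funext fun k => ?_⟩
    have hj' : t j = -t i := by linear_combination hij
    have hother : ∀ k, k ≠ 0 → k ≠ 1 → t (τ k) = 0 := fun k hk0 hk1 =>
      hk _ (fun h => hk0 (τ.injective (h.trans hτ0.symm)))
        (fun h => hk1 (τ.injective (h.trans hτ1.symm)))
    fin_cases k
    · simp [hτ0]
    · simp [hτ1, hj']
    · simpa using hother 2 (by decide) (by decide)
    · simpa using hother 3 (by decide) (by decide)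
    · simpa using hother 4 (by decide) (by decide)
  · rintro ⟨σ, a, ha, hσ⟩
    have ht' : t = (![a, -a, 0, 0, 0] : Fin 5 → ℂ) ∘ σ.symm := by
      rw [← hσ]; ext k; simp
    have key : ∀ k, (∑ S ∈ (univ.erase k).powersetCard 3, ∏ j ∈ S, t j) = 0 := by
      intro k
      rw [ht']
      show (∑ S ∈ (univ.erase k).powersetCard 3,
        ∏ j ∈ S, (![a, -a, 0, 0, 0] : Fin 5 → ℂ) (σ.symm j)) = 0
      rw [psum_comp_perm, psum_expand]
      generalize σ.symm k = m
      fin_cases m <;> simp <;> ring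
    intro i i'
    rw [key, key]

end Summit.KontsevichZagierPeriods.HardSphereVirial
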